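import Summits.CriticalPhenomena.PercolationContinuityZ3.Theorems.PercNearOneGluingNoHeavyLowerTailSahiTangentChain
import Literature.Combinatorics.Sahi2008.ProvedCases

/-!
# `NoHeavyLowerTail` (crux stmt-CriticalPhenomena-4575), Sahi programme: **THE TANGENT / CONTRACTION INEQUALITY HOLDS ON EVERY FKG
# LATTICE `Bool × α` FOR SLOTS WHOSE BOTTOM SECTIONS ARE PRINCIPAL UP-SETS** (top sections arbitrary) — by a thirteen-number lemma

Support file (Sahi cell, seat `prim-sahi-p1`, generation 49; `--supports stmt-CriticalPhenomena-4575`).  Pure proofs, NO definitions, no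
`sorry`, standard axioms.  Vocabulary: `sahiE`, `ex`, `setInd`, `IsFKGMeasure` (`Literature/Combinatorics/Sahi2008`), `mass`, `principalUp`,
`latticeE3` (`Literature/Probability/LatticeModels/SahiThirdOrderCorrelation`); the two-layer weight `(p·ν₁ on top, (1−p)·ν₀ below)` on
`Bool × α` and the pair slots `F_l(ε,x) = (ε ? χ_{U_l¹} x : χ_{U_l⁰} x)` exactly as in `…SahiTangentChain` (prim-sahi-p2 gen 32).

CONTEXT.  Conjecture T₃ of memo FROM-prim-sahi-p2-gen32-TANGENT — `T₃ := E₃(1) − E₃′(1) ≥ 0`, equivalently the contraction inequality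
`ν(top)·E₃^{ν(·|top)}(χ_{U¹}) ≤ E₃^{ν}(F_U)` for three increasing events of `Bool × α` under an FKG weight `ν` — is FALSE in general
(`{0,1}⁴ × coin`, seat gen 47 / census W161) and was proved for chains (p2 gen 32; all orders gen 47), for J-width ≤ 2 (gen 48) and for CYLINDER
PAIRS under PRODUCT measures on cubes (gen 48, `SahiTangentCyl.sahiE_three_coin_cylinders_ge`); "principal pairs under every FKG weight" was
left as a conjecture (memo FROM-prim-sahi-p1-gen48-TANGENT-WIDTH-TWO §1 (1.8), §6 (0)).  THIS FILE settles it in a stronger form: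
**only the three BOTTOM sections need to be principal up-sets; the top sections are arbitrary up-sets, the weight any FKG weight on any finite
distributive lattice (indeed any pair of log-supermodular probability weights `ν₀ ≼ ν₁`).**  All census W161 violations on `{0,1}⁴ × coin`
have a non-principal bottom, as they must.

THE MATHEMATICS.  With `X_S = ν₁(⋂_{l∈S} U_l¹)`, `Y_S = ν₀(⋂_{l∈S} U_l⁰)` (`S ⊆ {0,1,2}`), `T = Y_{012}`, `P = X_0X_1X_2`, the bracket of
`sahiE_three_sections` is `T₃ = 2T − 2P + Σ_a [(X_a − Y_a)X_{bc} + Y_aX_bX_c − X_aY_{bc}]` (`{b,c}` the other two slots).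
* THIRTEEN-NUMBER LEMMA (`tangent13_nonneg`): nonnegative reals with (H1) `Y_a ≤ X_a`, `Y_{bc} ≤ X_{bc}`; (H2) `X_bX_c ≤ X_{bc}`;
  (H3) `Y_a·Y_{bc} ≤ T`; (H4) `Y_{ab}·Y_{ac} ≤ Y_a·T` imply `T₃ ≥ 0`.  Proof: `w_a := min(X_aY_{bc}, Y_aY_{bc} + (X_a−Y_a)X_bX_c)`; the `a`-th
  summand is `≥ P − w_a` (H1, H2), so `T₃ ≥ 2T + P − Σ_a w_a`; and `w_a ≤ T + (X_a−Y_a)X_bX_c` (H3), `w_bw_c ≤ X_bY_{ac}·X_cY_{ab} ≤ X_bX_c·Y_a·T`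
  (H4) give `T·w_a + w_b·w_c ≤ T² + P·T` for each `a`, whence `Σ_a w_a ≤ 2T + P` by the
* THREE-NUMBER LEMMA (`three_number_lemma`): `0 ≤ u_a ≤ T + P`, `T·u_a + u_b·u_c ≤ T² + PT` (all `a`) ⟹ `u_0+u_1+u_2 ≤ 2T + P` (two of the
  `u_a` lie on the same side of `T`; multiply out `(u_a − T)(u_b − T) ≥ 0`).  Equality e.g. at `(u) = (T, T, P)`.
* IN THE LATTICE (`tangent_principalBottom_masses`): H1 = `U_l⁰ ⊆ U_l¹` plus domination `ν₀ ≼ ν₁` on up-sets; H2 = Harris for `ν₁`; H3 = Harris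
  for `ν₀`; H4 = Harris for `ν₀` CONDITIONED ON THE PRINCIPAL BOTTOM `↑b_a` (Blinovsky's device, `fkg_upperSet_mass_principal`) — the one place
  where principality enters, and exactly what fails for the census counterexamples (third bottom `x₀x₁ ∨ x₁x₃ ∨ x₂x₃`: `1/36 > 5/432`).
* CONSEQUENCES: `sahiE_three_sections_principalBottom_ge` (two weights `ν₀ ≼ ν₁`), `sahiE_three_coin_principalBottom_ge` (coin products
  `B_p ⊗ μ`, `μ` FKG — contains the chain theorem at order 3, the cylinder-pair theorem of gen 48 restricted to cubes, and the conjecture of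
  gen 48 §6(0)), `sahiE_three_fkg_principalBottom_ge` (every FKG weight `ν` on `Bool × α`, `0 < ν(top) < 1`:
  `ν(top)·E₃^{ν(·|top)}(χ_{U},χ_{V},χ_{W}) ≤ E₃^{ν}(F)` whenever the bottom sections are `↑u ⊆ U`, `↑v ⊆ V`, `↑w ⊆ W`).
HONEST LABEL: Conjecture T₃ for non-principal bottoms (e.g. J-width 3, or the percolation inequality R23, whose bottoms are connection events of
`G − e`) is NOT addressed; nothing is asserted about Sahi's `C_n`, Kahn's conjecture or the increasing star. [this work]
-/

namespace Summit.CriticalPhenomena.PercolationContinuityZ3.Theorems.SahiTangent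

open Finset Function Literature.Combinatorics.Sahi2008
open Literature.Probability.LatticeModels (mass mass_nonneg mass_mono mass_univ principalUp mem_principalUp isUpperSet_principalUp
  fkg_upperSet_mass fkg_upperSet_mass_principal latticeE3 latticeE3_nonneg_of_principal)
open scoped BigOperators

noncomputable section

/-! ### The two elementary lemmas -/

section Elementary

/-- **Three-number lemma.**  If `T, P ≥ 0`, `0 ≤ u_a ≤ T + P` and `T·u_a + u_b·u_c ≤ T² + P·T` for each of the three indices `a`
(`{b,c}` the other two), then `u_0 + u_1 + u_2 ≤ 2T + P`.  (Two of the `u_a` lie on the same side of `T`; expand `(u_a − T)(u_b − T) ≥ 0`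
and add the third hypothesis.  Sharp: `(T,T,P)`.) [this work] -/
theorem three_number_lemma {T P u₀ u₁ u₂ : ℝ} (hT : 0 ≤ T) (h₀ : 0 ≤ u₀) (h₁ : 0 ≤ u₁) (h₂ : 0 ≤ u₂)
    (hb₀ : u₀ ≤ T + P) (hb₁ : u₁ ≤ T + P) (hb₂ : u₂ ≤ T + P)
    (hp₀ : T * u₀ + u₁ * u₂ ≤ T ^ 2 + P * T) (hp₁ : T * u₁ + u₀ * u₂ ≤ T ^ 2 + P * T)
    (hp₂ : T * u₂ + u₀ * u₁ ≤ T ^ 2 + P * T) : u₀ + u₁ + u₂ ≤ 2 * T + P := by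
  rcases hT.eq_or_lt with hT0 | hTpos
  · -- `T = 0`: the pairwise products vanish, so at most one `u_a` is nonzero, and each is `≤ P`
    subst hT0
    have q₁₂ : u₁ * u₂ ≤ 0 := by linarith [hp₀]
    have q₀₂ : u₀ * u₂ ≤ 0 := by linarith [hp₁]
    have q₀₁ : u₀ * u₁ ≤ 0 := by linarith [hp₂]
    rcases h₀.eq_or_lt with e₀ | p₀
    · rcases h₁.eq_or_lt with e₁ | p₁
      · rw [← e₀, ← e₁]; linarith
      · have e₂ : u₂ = 0 := le_antisymm (by nlinarith) h₂
        rw [← e₀, e₂]; linarith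
    · have e₁ : u₁ = 0 := le_antisymm (by nlinarith) h₁
      have e₂ : u₂ = 0 := le_antisymm (by nlinarith) h₂
      rw [e₁, e₂]; linarith
  · have key : T * (u₀ + u₁ + u₂) ≤ T * (2 * T + P) := by
      rcases le_total u₀ T with a₀ | a₀ <;> rcases le_total u₁ T with a₁ | a₁ <;> rcases le_total u₂ T with a₂ | a₂
      all_goals
        first
        | linarith [mul_nonneg (sub_nonneg.2 a₀) (sub_nonneg.2 a₁), hp₂]
        | linarith [mul_nonneg (sub_nonneg.2 a₀) (sub_nonneg.2 a₂), hp₁]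
        | linarith [mul_nonneg (sub_nonneg.2 a₁) (sub_nonneg.2 a₂), hp₀]
    exact le_of_mul_le_mul_left key hTpos

/-- **Thirteen-number lemma** — the tangent bracket `T₃` is nonnegative under the four families of Harris-type hypotheses
(H1) `Y_a ≤ X_a`, `Y_{bc} ≤ X_{bc}`; (H2) `X_bX_c ≤ X_{bc}`; (H3) `Y_a·Y_{bc} ≤ T`; (H4) `Y_{ab}·Y_{ac} ≤ Y_a·T`.  The conclusion is the bracket of
`sahiE_three_sections` with `X_S`, `Y_S` the top / bottom moments and `T = Y_{012}`. [this work] -/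
theorem tangent13_nonneg {X₀ X₁ X₂ X₀₁ X₀₂ X₁₂ Y₀ Y₁ Y₂ Y₀₁ Y₀₂ Y₁₂ T : ℝ}
    (hX₀ : 0 ≤ X₀) (hX₁ : 0 ≤ X₁) (hX₂ : 0 ≤ X₂) (hY₀ : 0 ≤ Y₀) (hY₁ : 0 ≤ Y₁) (hY₂ : 0 ≤ Y₂)
    (hY₀₁ : 0 ≤ Y₀₁) (hY₀₂ : 0 ≤ Y₀₂) (hY₁₂ : 0 ≤ Y₁₂) (hT : 0 ≤ T)
    (d₀ : Y₀ ≤ X₀) (d₁ : Y₁ ≤ X₁) (d₂ : Y₂ ≤ X₂) (d₀₁ : Y₀₁ ≤ X₀₁) (d₀₂ : Y₀₂ ≤ X₀₂) (d₁₂ : Y₁₂ ≤ X₁₂)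
    (c₀₁ : X₀ * X₁ ≤ X₀₁) (c₀₂ : X₀ * X₂ ≤ X₀₂) (c₁₂ : X₁ * X₂ ≤ X₁₂)
    (b₀ : Y₀ * Y₁₂ ≤ T) (b₁ : Y₁ * Y₀₂ ≤ T) (b₂ : Y₂ * Y₀₁ ≤ T)
    (a₀ : Y₀₁ * Y₀₂ ≤ Y₀ * T) (a₁ : Y₀₁ * Y₁₂ ≤ Y₁ * T) (a₂ : Y₀₂ * Y₁₂ ≤ Y₂ * T) :
    0 ≤ 2 * T + (X₀ - Y₀) * X₁₂ + (X₁ - Y₁) * X₀₂ + (X₂ - Y₂) * X₀₁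
        + Y₀ * X₁ * X₂ + Y₁ * X₀ * X₂ + Y₂ * X₀ * X₁ - X₀ * Y₁₂ - X₁ * Y₀₂ - X₂ * Y₀₁ - 2 * X₀ * X₁ * X₂ := by
  set w₀ := min (X₀ * Y₁₂) (Y₀ * Y₁₂ + (X₀ - Y₀) * (X₁ * X₂)) with hw₀
  set w₁ := min (X₁ * Y₀₂) (Y₁ * Y₀₂ + (X₁ - Y₁) * (X₀ * X₂)) with hw₁
  set w₂ := min (X₂ * Y₀₁) (Y₂ * Y₀₁ + (X₂ - Y₂) * (X₀ * X₁)) with hw₂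
  -- the `w_a` are nonnegative
  have n₀ : 0 ≤ w₀ :=
    le_min (mul_nonneg hX₀ hY₁₂) (add_nonneg (mul_nonneg hY₀ hY₁₂) (mul_nonneg (sub_nonneg.2 d₀) (mul_nonneg hX₁ hX₂)))
  have n₁ : 0 ≤ w₁ :=
    le_min (mul_nonneg hX₁ hY₀₂) (add_nonneg (mul_nonneg hY₁ hY₀₂) (mul_nonneg (sub_nonneg.2 d₁) (mul_nonneg hX₀ hX₂)))
  have n₂ : 0 ≤ w₂ :=
    le_min (mul_nonneg hX₂ hY₀₁) (add_nonneg (mul_nonneg hY₂ hY₀₁) (mul_nonneg (sub_nonneg.2 d₂) (mul_nonneg hX₀ hX₁)))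
  -- the two upper bounds (the two branches of the `min`)
  have u₀a : w₀ ≤ X₀ * Y₁₂ := min_le_left _ _
  have u₀b : w₀ ≤ Y₀ * Y₁₂ + (X₀ - Y₀) * (X₁ * X₂) := min_le_right _ _
  have u₁a : w₁ ≤ X₁ * Y₀₂ := min_le_left _ _
  have u₁b : w₁ ≤ Y₁ * Y₀₂ + (X₁ - Y₁) * (X₀ * X₂) := min_le_right _ _
  have u₂a : w₂ ≤ X₂ * Y₀₁ := min_le_left _ _
  have u₂b : w₂ ≤ Y₂ * Y₀₁ + (X₂ - Y₂) * (X₀ * X₁) := min_le_right _ _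
  -- the lower bound: the `a`-th summand of `T₃` is `≥ P − w_a`
  have l₀ : X₀ * Y₁₂ - (X₀ - Y₀) * (X₁₂ - X₁ * X₂) ≤ w₀ := by
    refine le_min ?_ ?_
    · linarith [mul_nonneg (sub_nonneg.2 d₀) (sub_nonneg.2 c₁₂)]
    · linarith [mul_nonneg (sub_nonneg.2 d₀) (sub_nonneg.2 d₁₂)]
  have l₁ : X₁ * Y₀₂ - (X₁ - Y₁) * (X₀₂ - X₀ * X₂) ≤ w₁ := by
    refine le_min ?_ ?_
    · linarith [mul_nonneg (sub_nonneg.2 d₁) (sub_nonneg.2 c₀₂)]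
    · linarith [mul_nonneg (sub_nonneg.2 d₁) (sub_nonneg.2 d₀₂)]
  have l₂ : X₂ * Y₀₁ - (X₂ - Y₂) * (X₀₁ - X₀ * X₁) ≤ w₂ := by
    refine le_min ?_ ?_
    · linarith [mul_nonneg (sub_nonneg.2 d₂) (sub_nonneg.2 c₀₁)]
    · linarith [mul_nonneg (sub_nonneg.2 d₂) (sub_nonneg.2 d₀₁)]
  -- the hypotheses of the three-number lemma
  have m₁₂ : w₁ * w₂ ≤ (X₁ * Y₀₂) * (X₂ * Y₀₁) := mul_le_mul u₁a u₂a n₂ (mul_nonneg hX₁ hY₀₂)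
  have m₀₂ : w₀ * w₂ ≤ (X₀ * Y₁₂) * (X₂ * Y₀₁) := mul_le_mul u₀a u₂a n₂ (mul_nonneg hX₀ hY₁₂)
  have m₀₁ : w₀ * w₁ ≤ (X₀ * Y₁₂) * (X₁ * Y₀₂) := mul_le_mul u₀a u₁a n₁ (mul_nonneg hX₀ hY₁₂)
  have k₀ : (X₁ * Y₀₂) * (X₂ * Y₀₁) ≤ X₁ * X₂ * (Y₀ * T) := by
    linarith [mul_le_mul_of_nonneg_left a₀ (mul_nonneg hX₁ hX₂)]
  have k₁ : (X₀ * Y₁₂) * (X₂ * Y₀₁) ≤ X₀ * X₂ * (Y₁ * T) := by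
    linarith [mul_le_mul_of_nonneg_left a₁ (mul_nonneg hX₀ hX₂)]
  have k₂ : (X₀ * Y₁₂) * (X₁ * Y₀₂) ≤ X₀ * X₁ * (Y₂ * T) := by
    linarith [mul_le_mul_of_nonneg_left a₂ (mul_nonneg hX₀ hX₁)]
  have t₀' : T * w₀ ≤ T * T + T * ((X₀ - Y₀) * (X₁ * X₂)) := by
    linarith [mul_le_mul_of_nonneg_left u₀b hT, mul_le_mul_of_nonneg_left b₀ hT]
  have t₁' : T * w₁ ≤ T * T + T * ((X₁ - Y₁) * (X₀ * X₂)) := by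
    linarith [mul_le_mul_of_nonneg_left u₁b hT, mul_le_mul_of_nonneg_left b₁ hT]
  have t₂' : T * w₂ ≤ T * T + T * ((X₂ - Y₂) * (X₀ * X₁)) := by
    linarith [mul_le_mul_of_nonneg_left u₂b hT, mul_le_mul_of_nonneg_left b₂ hT]
  have t₀ : T * w₀ + w₁ * w₂ ≤ T ^ 2 + (X₀ * X₁ * X₂) * T := by linarith [m₁₂, k₀, t₀']
  have t₁ : T * w₁ + w₀ * w₂ ≤ T ^ 2 + (X₀ * X₁ * X₂) * T := by linarith [m₀₂, k₁, t₁']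
  have t₂ : T * w₂ + w₀ * w₁ ≤ T ^ 2 + (X₀ * X₁ * X₂) * T := by linarith [m₀₁, k₂, t₂']
  have e₀ : w₀ ≤ T + X₀ * X₁ * X₂ := by linarith [u₀b, b₀, mul_nonneg hY₀ (mul_nonneg hX₁ hX₂)]
  have e₁ : w₁ ≤ T + X₀ * X₁ * X₂ := by linarith [u₁b, b₁, mul_nonneg hY₁ (mul_nonneg hX₀ hX₂)]
  have e₂ : w₂ ≤ T + X₀ * X₁ * X₂ := by linarith [u₂b, b₂, mul_nonneg hY₂ (mul_nonneg hX₀ hX₁)]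
  have key := three_number_lemma hT n₀ n₁ n₂ e₀ e₁ e₂ t₀ t₁ t₂
  linarith [l₀, l₁, l₂, key]

end Elementary

/-! ### The lattice: principal bottoms, arbitrary tops, two dominated log-supermodular weights -/

section Lattice

variable {α : Type*} [DistribLattice α] [Fintype α] [DecidableEq α] [DecidableLE α]

/-- **`T₃ ≥ 0` for principal bottoms, mass form.**  Two nonnegative log-supermodular weights `ν₀, ν₁` of mass `1` on a finite distributive
lattice with `ν₀ ≼ ν₁` on up-sets; top up-sets `U, V, W` (arbitrary) containing the principal bottoms `↑u, ↑v, ↑w`.  Then the tangent bracket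
(the `p`-coefficient of `sahiE_three_sections`, with `X_S = ν₁(⋂ tops)`, `Y_S = ν₀(⋂ bottoms)`) is nonnegative. [this work] -/
theorem tangent_principalBottom_masses {ν₀ ν₁ : α → ℝ} (h₀ : 0 ≤ ν₀) (hl₀ : ∀ a b, ν₀ a * ν₀ b ≤ ν₀ (a ⊓ b) * ν₀ (a ⊔ b))
    (hZ₀ : ∑ x, ν₀ x = 1) (h₁ : 0 ≤ ν₁) (hl₁ : ∀ a b, ν₁ a * ν₁ b ≤ ν₁ (a ⊓ b) * ν₁ (a ⊔ b)) (hZ₁ : ∑ x, ν₁ x = 1)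
    (hdom : ∀ A : Finset α, IsUpperSet (A : Set α) → mass ν₀ A ≤ mass ν₁ A)
    {U V W : Finset α} (hU : IsUpperSet (U : Set α)) (hV : IsUpperSet (V : Set α)) (hW : IsUpperSet (W : Set α))
    {u v w : α} (huU : principalUp u ⊆ U) (hvV : principalUp v ⊆ V) (hwW : principalUp w ⊆ W) :
    0 ≤ 2 * mass ν₀ (principalUp u ∩ principalUp v ∩ principalUp w)
      + (mass ν₁ U - mass ν₀ (principalUp u)) * mass ν₁ (V ∩ W)
      + (mass ν₁ V - mass ν₀ (principalUp v)) * mass ν₁ (U ∩ W)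
      + (mass ν₁ W - mass ν₀ (principalUp w)) * mass ν₁ (U ∩ V)
      + mass ν₀ (principalUp u) * mass ν₁ V * mass ν₁ W
      + mass ν₀ (principalUp v) * mass ν₁ U * mass ν₁ W
      + mass ν₀ (principalUp w) * mass ν₁ U * mass ν₁ V
      - mass ν₁ U * mass ν₀ (principalUp v ∩ principalUp w)
      - mass ν₁ V * mass ν₀ (principalUp u ∩ principalUp w)
      - mass ν₁ W * mass ν₀ (principalUp u ∩ principalUp v)
      - 2 * mass ν₁ U * mass ν₁ V * mass ν₁ W := by
  have hZ₀' : mass ν₀ univ = 1 := by rw [mass_univ]; exact hZ₀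
  have hZ₁' : mass ν₁ univ = 1 := by rw [mass_univ]; exact hZ₁
  have hu := isUpperSet_principalUp (α := α) u
  have hv := isUpperSet_principalUp (α := α) v
  have hw := isUpperSet_principalUp (α := α) w
  have huv : IsUpperSet ((principalUp u ∩ principalUp v : Finset α) : Set α) := by
    rw [Finset.coe_inter]; exact hu.inter hv
  have huw : IsUpperSet ((principalUp u ∩ principalUp w : Finset α) : Set α) := by
    rw [Finset.coe_inter]; exact hu.inter hw
  have hvw : IsUpperSet ((principalUp v ∩ principalUp w : Finset α) : Set α) := by
    rw [Finset.coe_inter]; exact hv.inter hw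
  -- (H1) domination and `U⁰ ⊆ U¹`
  have d₀ : mass ν₀ (principalUp u) ≤ mass ν₁ U := (hdom _ hu).trans (mass_mono h₁ huU)
  have d₁ : mass ν₀ (principalUp v) ≤ mass ν₁ V := (hdom _ hv).trans (mass_mono h₁ hvV)
  have d₂ : mass ν₀ (principalUp w) ≤ mass ν₁ W := (hdom _ hw).trans (mass_mono h₁ hwW)
  have d₀₁ : mass ν₀ (principalUp u ∩ principalUp v) ≤ mass ν₁ (U ∩ V) :=
    (hdom _ huv).trans (mass_mono h₁ (Finset.inter_subset_inter huU hvV))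
  have d₀₂ : mass ν₀ (principalUp u ∩ principalUp w) ≤ mass ν₁ (U ∩ W) :=
    (hdom _ huw).trans (mass_mono h₁ (Finset.inter_subset_inter huU hwW))
  have d₁₂ : mass ν₀ (principalUp v ∩ principalUp w) ≤ mass ν₁ (V ∩ W) :=
    (hdom _ hvw).trans (mass_mono h₁ (Finset.inter_subset_inter hvV hwW))
  -- (H2) Harris for the tops under `ν₁`
  have c₀₁ : mass ν₁ U * mass ν₁ V ≤ mass ν₁ (U ∩ V) := by
    have h := fkg_upperSet_mass h₁ hl₁ hU hV
    rw [hZ₁', one_mul] at h; exact h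
  have c₀₂ : mass ν₁ U * mass ν₁ W ≤ mass ν₁ (U ∩ W) := by
    have h := fkg_upperSet_mass h₁ hl₁ hU hW
    rw [hZ₁', one_mul] at h; exact h
  have c₁₂ : mass ν₁ V * mass ν₁ W ≤ mass ν₁ (V ∩ W) := by
    have h := fkg_upperSet_mass h₁ hl₁ hV hW
    rw [hZ₁', one_mul] at h; exact h
  -- (H3) Harris for the bottoms under `ν₀`
  have b₀ : mass ν₀ (principalUp u) * mass ν₀ (principalUp v ∩ principalUp w) ≤
      mass ν₀ (principalUp u ∩ principalUp v ∩ principalUp w) := by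
    have h := fkg_upperSet_mass h₀ hl₀ hu hvw
    rw [hZ₀', one_mul, ← Finset.inter_assoc] at h; exact h
  have b₁ : mass ν₀ (principalUp v) * mass ν₀ (principalUp u ∩ principalUp w) ≤
      mass ν₀ (principalUp u ∩ principalUp v ∩ principalUp w) := by
    have h := fkg_upperSet_mass h₀ hl₀ hv huw
    rw [hZ₀', one_mul, Finset.inter_left_comm, ← Finset.inter_assoc] at h; exact h
  have b₂ : mass ν₀ (principalUp w) * mass ν₀ (principalUp u ∩ principalUp v) ≤
      mass ν₀ (principalUp u ∩ principalUp v ∩ principalUp w) := by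
    have h := fkg_upperSet_mass h₀ hl₀ hw huv
    rw [hZ₀', one_mul, Finset.inter_comm (principalUp w) (principalUp u ∩ principalUp v)] at h; exact h
  -- (H4) Harris for the bottoms under `ν₀` conditioned on each (principal!) bottom
  have a₀ : mass ν₀ (principalUp u ∩ principalUp v) * mass ν₀ (principalUp u ∩ principalUp w) ≤
      mass ν₀ (principalUp u) * mass ν₀ (principalUp u ∩ principalUp v ∩ principalUp w) := by
    have h := fkg_upperSet_mass_principal h₀ hl₀ hv hw u
    have e1 : principalUp v ∩ principalUp u = principalUp u ∩ principalUp v := Finset.inter_comm _ _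
    have e2 : principalUp w ∩ principalUp u = principalUp u ∩ principalUp w := Finset.inter_comm _ _
    have e3 : principalUp v ∩ principalUp w ∩ principalUp u = principalUp u ∩ principalUp v ∩ principalUp w := by
      rw [Finset.inter_comm, ← Finset.inter_assoc]
    rw [e1, e2, e3] at h; exact h
  have a₁ : mass ν₀ (principalUp u ∩ principalUp v) * mass ν₀ (principalUp v ∩ principalUp w) ≤
      mass ν₀ (principalUp v) * mass ν₀ (principalUp u ∩ principalUp v ∩ principalUp w) := by
    have h := fkg_upperSet_mass_principal h₀ hl₀ hu hw v
    have e2 : principalUp w ∩ principalUp v = principalUp v ∩ principalUp w := Finset.inter_comm _ _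
    have e3 : principalUp u ∩ principalUp w ∩ principalUp v = principalUp u ∩ principalUp v ∩ principalUp w :=
      Finset.inter_right_comm _ _ _
    rw [e2, e3] at h; exact h
  have a₂ : mass ν₀ (principalUp u ∩ principalUp w) * mass ν₀ (principalUp v ∩ principalUp w) ≤
      mass ν₀ (principalUp w) * mass ν₀ (principalUp u ∩ principalUp v ∩ principalUp w) :=
    fkg_upperSet_mass_principal h₀ hl₀ hu hv w
  have key := tangent13_nonneg (mass_nonneg h₁ U) (mass_nonneg h₁ V) (mass_nonneg h₁ W) (mass_nonneg h₀ _) (mass_nonneg h₀ _)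
    (mass_nonneg h₀ _) (mass_nonneg h₀ _) (mass_nonneg h₀ _) (mass_nonneg h₀ _) (mass_nonneg h₀ _)
    d₀ d₁ d₂ d₀₁ d₀₂ d₁₂ c₀₁ c₀₂ c₁₂ b₀ b₁ b₂ a₀ a₁ a₂
  linarith [key]

/-- **THE CONTRACTION INEQUALITY, TWO WEIGHTS.**  `ν₀, ν₁` nonnegative log-supermodular probability weights on a finite distributive lattice
with `ν₀ ≼ ν₁` on up-sets; `p ∈ [0,1]`; `ν = (p·ν₁ on the top layer, (1−p)·ν₀ on the bottom layer)` of `Bool × α`; slots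
`F_U(ε,x) = (ε ? χ_U x : χ_{↑u} x)` etc. with `↑u ⊆ U`, `↑v ⊆ V`, `↑w ⊆ W`, the tops ARBITRARY up-sets.  Then
`p · E₃^{ν₁}(χ_U, χ_V, χ_W) ≤ E₃^{ν}(F_U, F_V, F_W)`. [this work] -/
theorem sahiE_three_sections_principalBottom_ge {ν₀ ν₁ : α → ℝ} (h₀ : 0 ≤ ν₀)
    (hl₀ : ∀ a b, ν₀ a * ν₀ b ≤ ν₀ (a ⊓ b) * ν₀ (a ⊔ b)) (hZ₀ : ∑ x, ν₀ x = 1) (h₁ : 0 ≤ ν₁)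
    (hl₁ : ∀ a b, ν₁ a * ν₁ b ≤ ν₁ (a ⊓ b) * ν₁ (a ⊔ b)) (hZ₁ : ∑ x, ν₁ x = 1)
    (hdom : ∀ A : Finset α, IsUpperSet (A : Set α) → mass ν₀ A ≤ mass ν₁ A)
    {U V W : Finset α} (hU : IsUpperSet (U : Set α)) (hV : IsUpperSet (V : Set α)) (hW : IsUpperSet (W : Set α))
    {u v w : α} (huU : principalUp u ⊆ U) (hvV : principalUp v ⊆ V) (hwW : principalUp w ⊆ W)
    {p : ℝ} (hp₀ : 0 ≤ p) (hp₁ : p ≤ 1) :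
    p * sahiE ν₁ 3 ![setInd U, setInd V, setInd W] ≤
      sahiE (fun z : Bool × α => if z.1 then p * ν₁ z.2 else (1 - p) * ν₀ z.2) 3
        ![fun z => if z.1 then setInd U z.2 else setInd (principalUp u) z.2,
          fun z => if z.1 then setInd V z.2 else setInd (principalUp v) z.2,
          fun z => if z.1 then setInd W z.2 else setInd (principalUp w) z.2] := by
  have key := sahiE_three_sections ν₀ ν₁ p
    ![fun z => if z.1 then setInd U z.2 else setInd (principalUp u) z.2,
      fun z => if z.1 then setInd V z.2 else setInd (principalUp v) z.2,
      fun z => if z.1 then setInd W z.2 else setInd (principalUp w) z.2]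
  simp only [Matrix.cons_val_zero, Matrix.cons_val_one, Matrix.cons_val_two, Matrix.head_cons, Matrix.tail_cons,
    if_true, if_false, Bool.false_eq_true] at key
  -- eta-contract the sections and turn products of indicators into masses of intersections
  have e0 : (fun x => setInd U x) = setInd U := rfl
  have e1 : (fun x => setInd V x) = setInd V := rfl
  have e2 : (fun x => setInd W x) = setInd W := rfl
  have e3 : (fun x => setInd (principalUp u) x) = setInd (principalUp u) := rfl
  have e4 : (fun x => setInd (principalUp v) x) = setInd (principalUp v) := rfl
  have e5 : (fun x => setInd (principalUp w) x) = setInd (principalUp w) := rfl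
  have m1 : (fun x => setInd (principalUp u) x * setInd (principalUp v) x * setInd (principalUp w) x)
      = setInd (principalUp u) * setInd (principalUp v) * setInd (principalUp w) := rfl
  have m2 : (fun x => setInd V x * setInd W x) = setInd V * setInd W := rfl
  have m3 : (fun x => setInd U x * setInd W x) = setInd U * setInd W := rfl
  have m4 : (fun x => setInd U x * setInd V x) = setInd U * setInd V := rfl
  have m5 : (fun x => setInd (principalUp v) x * setInd (principalUp w) x) = setInd (principalUp v) * setInd (principalUp w) := rfl
  have m6 : (fun x => setInd (principalUp u) x * setInd (principalUp w) x) = setInd (principalUp u) * setInd (principalUp w) := rfl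
  have m7 : (fun x => setInd (principalUp u) x * setInd (principalUp v) x) = setInd (principalUp u) * setInd (principalUp v) := rfl
  rw [e0, e1, e2, e3, e4, e5, m1, m2, m3, m4, m5, m6, m7] at key
  simp only [setInd_mul, ex_setInd] at key
  -- the three nonnegative ingredients
  have hT := tangent_principalBottom_masses h₀ hl₀ hZ₀ h₁ hl₁ hZ₁ hdom hU hV hW huU hvV hwW
  have hc₀ : 0 ≤ sahiE ν₀ 3 ![setInd (principalUp u), setInd (principalUp v), setInd (principalUp w)] := by
    rw [sahiE_three_indicator_eq_latticeE3 hZ₀]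
    exact latticeE3_nonneg_of_principal h₀ hl₀ (isUpperSet_principalUp u) (isUpperSet_principalUp v) w
  have hD : 0 ≤ (mass ν₁ U - mass ν₀ (principalUp u)) * (mass ν₁ V - mass ν₀ (principalUp v))
      * (mass ν₁ W - mass ν₀ (principalUp w)) :=
    mul_nonneg (mul_nonneg
      (sub_nonneg.2 ((hdom _ (isUpperSet_principalUp u)).trans (mass_mono h₁ huU)))
      (sub_nonneg.2 ((hdom _ (isUpperSet_principalUp v)).trans (mass_mono h₁ hvV))))
      (sub_nonneg.2 ((hdom _ (isUpperSet_principalUp w)).trans (mass_mono h₁ hwW)))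
  have h1p : 0 ≤ 1 - p := sub_nonneg.2 hp₁
  nlinarith [key, mul_nonneg h1p (mul_nonneg h1p hc₀), mul_nonneg h1p (mul_nonneg hp₀ hT),
    mul_nonneg h1p (mul_nonneg (mul_nonneg hp₀ h1p) hD)]

/-- **Coin products.**  For an FKG probability weight `μ` on a finite distributive lattice, `p ∈ [0,1]`, arbitrary top up-sets `U, V, W` and
principal bottoms `↑u ⊆ U`, `↑v ⊆ V`, `↑w ⊆ W`:  `p · E₃^{μ}(χ_U,χ_V,χ_W) ≤ E₃^{B_p ⊗ μ}(F_U,F_V,F_W)` — `p ↦ E₃^{B_p⊗μ}(F)/p` is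
non-increasing.  (Chains: every up-set is principal — p2 gen 32's theorem at order 3; cubes with cylinder tops AND bottoms: gen 48's
`SahiTangentCyl.sahiE_three_coin_cylinders_ge` for product weights, here for every FKG weight and arbitrary increasing tops.) [this work] -/
theorem sahiE_three_coin_principalBottom_ge {μ : α → ℝ} (hμ : IsFKGMeasure μ)
    {U V W : Finset α} (hU : IsUpperSet (U : Set α)) (hV : IsUpperSet (V : Set α)) (hW : IsUpperSet (W : Set α))
    {u v w : α} (huU : principalUp u ⊆ U) (hvV : principalUp v ⊆ V) (hwW : principalUp w ⊆ W)
    {p : ℝ} (hp₀ : 0 ≤ p) (hp₁ : p ≤ 1) :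
    p * sahiE μ 3 ![setInd U, setInd V, setInd W] ≤
      sahiE (fun z : Bool × α => if z.1 then p * μ z.2 else (1 - p) * μ z.2) 3
        ![fun z => if z.1 then setInd U z.2 else setInd (principalUp u) z.2,
          fun z => if z.1 then setInd V z.2 else setInd (principalUp v) z.2,
          fun z => if z.1 then setInd W z.2 else setInd (principalUp w) z.2] :=
  sahiE_three_sections_principalBottom_ge (fun x => hμ.nonneg x) hμ.mul_le_mul hμ.sum_eq_one (fun x => hμ.nonneg x)
    hμ.mul_le_mul hμ.sum_eq_one (fun _ _ => le_rfl) hU hV hW huU hvV hwW hp₀ hp₁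

omit [DecidableLE α] in
/-- The two sections of an FKG probability weight `ν` on `Bool × α` (`α` a finite distributive lattice) with `0 < ν(top), ν(bottom)` are
ordered on up-sets: `ν(A | bottom) ≤ ν(A | top)` — the FKG inequality for `χ_A ∘ snd` and `χ_{top}`.  (The tree's
`sections_dominated_of_fkg` is the chain case; the proof is the same.) [cite: FortuinKasteleynGinibre1971, Thm. (Prop. 1)] -/
theorem sections_dominated_of_fkg_lattice {ν : Bool × α → ℝ} (hν : IsFKGMeasure ν)
    (hq₀ : 0 < ∑ x, ν (true, x)) (hq₁ : 0 < ∑ x, ν (false, x)) (A : Finset α) (hA : IsUpperSet (A : Set α)) :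
    mass (fun x => ν (false, x) / ∑ y, ν (false, y)) A ≤ mass (fun x => ν (true, x) / ∑ y, ν (true, y)) A := by
  have hg : Monotone (fun z : Bool × α => if z.1 then (1 : ℝ) else 0) := by
    intro a b hab
    have h1 : a.1 ≤ b.1 := hab.1
    rcases ha : a.1 with _ | _ <;> rcases hb : b.1 with _ | _ <;> simp only [ha, hb] at h1 ⊢ <;> norm_num
    exact absurd h1 (by decide)
  have hf : Monotone (fun z : Bool × α => setInd A z.2) := fun a b hab => monotone_setInd hA hab.2
  have key := ex_mul_ex_le_ex_mul hν (fun z => setInd_nonneg A z.2) (fun z => by positivity) hf hg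
  have htot : ∑ z : Bool × α, ν z = 1 := hν.sum_eq_one
  rw [Fintype.sum_prod_type, Fintype.sum_bool] at htot
  simp only [ex, Fintype.sum_prod_type, Fintype.sum_bool, if_true, if_false, Bool.false_eq_true, Pi.mul_apply, mul_one,
    mul_zero, Finset.sum_const_zero, add_zero] at key
  rw [← ex_setInd, ← ex_setInd]
  simp only [ex, div_mul_eq_mul_div, ← Finset.sum_div]
  rw [div_le_div_iff₀ hq₁ hq₀]
  have hsplit : ∑ x, ν (true, x) = 1 - ∑ x, ν (false, x) := by linarith
  nlinarith [key, hsplit, Finset.sum_nonneg (fun x (_ : x ∈ Finset.univ) => mul_nonneg (hν.nonneg (true, x)) (setInd_nonneg A x)),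
    Finset.sum_nonneg (fun x (_ : x ∈ Finset.univ) => mul_nonneg (hν.nonneg (false, x)) (setInd_nonneg A x))]

/-- **THE CONTRACTION INEQUALITY FOR EVERY FKG WEIGHT ON `Bool × α`, PRINCIPAL BOTTOMS.**  `α` a finite distributive lattice, `ν` an FKG
probability weight on `Bool × α` (product order) with `q = ν(top) ∈ (0,1)`; three increasing events of `Bool × α` given by their sections,
top sections `U, V, W` ARBITRARY up-sets of `α`, bottom sections the principal up-sets `↑u ⊆ U`, `↑v ⊆ V`, `↑w ⊆ W`.  Then
`q · E₃^{ν(·|top)}(χ_U, χ_V, χ_W) ≤ E₃^{ν}(F_U, F_V, F_W)`,  i.e. Conjecture T₃ (`E₃ ≥ P(top)·E₃(·|top)`, memo FROM-prim-sahi-p2-gen32-TANGENT)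
holds for all slots with principal bottom sections. [this work] -/
theorem sahiE_three_fkg_principalBottom_ge {ν : Bool × α → ℝ} (hν : IsFKGMeasure ν)
    (hq₀ : 0 < ∑ x, ν (true, x)) (hq₁ : 0 < ∑ x, ν (false, x))
    {U V W : Finset α} (hU : IsUpperSet (U : Set α)) (hV : IsUpperSet (V : Set α)) (hW : IsUpperSet (W : Set α))
    {u v w : α} (huU : principalUp u ⊆ U) (hvV : principalUp v ⊆ V) (hwW : principalUp w ⊆ W) :
    (∑ x, ν (true, x)) * sahiE (fun x => ν (true, x) / ∑ y, ν (true, y)) 3 ![setInd U, setInd V, setInd W] ≤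
      sahiE ν 3 ![fun z => if z.1 then setInd U z.2 else setInd (principalUp u) z.2,
          fun z => if z.1 then setInd V z.2 else setInd (principalUp v) z.2,
          fun z => if z.1 then setInd W z.2 else setInd (principalUp w) z.2] := by
  set q := ∑ x, ν (true, x) with hq
  set ν₁ : α → ℝ := fun x => ν (true, x) / q with hν₁
  set ν₀ : α → ℝ := fun x => ν (false, x) / ∑ y, ν (false, y) with hν₀
  have htot : ∑ z : Bool × α, ν z = 1 := hν.sum_eq_one
  rw [Fintype.sum_prod_type, Fintype.sum_bool] at htot
  have hq1 : ∑ x, ν (false, x) = 1 - q := by rw [hq]; linarith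
  have hrepr : ν = fun z : Bool × α => if z.1 then q * ν₁ z.2 else (1 - q) * ν₀ z.2 := by
    funext z; rcases z with ⟨b, x⟩
    cases b
    · simp only [Bool.false_eq_true, if_false, hν₀, ← hq1]
      rw [mul_div_cancel₀ _ (ne_of_gt hq₁)]
    · simp only [if_true, hν₁]
      rw [mul_div_cancel₀ _ (ne_of_gt hq₀)]
  have h₀ : 0 ≤ ν₀ := fun x => div_nonneg (hν.nonneg _) hq₁.le
  have h₁ : 0 ≤ ν₁ := fun x => div_nonneg (hν.nonneg _) hq₀.le
  have h₀' : ∑ x, ν₀ x = 1 := by simp only [hν₀, ← Finset.sum_div]; exact div_self (ne_of_gt hq₁)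
  have h₁' : ∑ x, ν₁ x = 1 := by simp only [hν₁, ← Finset.sum_div]; exact div_self (ne_of_gt hq₀)
  -- the sections are log-supermodular (restriction of `ν` to the two layers, which are sublattices)
  have hl₀ : ∀ a b, ν₀ a * ν₀ b ≤ ν₀ (a ⊓ b) * ν₀ (a ⊔ b) := by
    intro a b
    have h := hν.mul_le_mul (false, a) (false, b)
    rw [Prod.mk_inf_mk, Prod.mk_sup_mk, inf_idem, sup_idem] at h
    simp only [hν₀]
    rw [div_mul_div_comm, div_mul_div_comm]
    exact div_le_div_of_nonneg_right h (mul_nonneg hq₁.le hq₁.le)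
  have hl₁ : ∀ a b, ν₁ a * ν₁ b ≤ ν₁ (a ⊓ b) * ν₁ (a ⊔ b) := by
    intro a b
    have h := hν.mul_le_mul (true, a) (true, b)
    rw [Prod.mk_inf_mk, Prod.mk_sup_mk, inf_idem, sup_idem] at h
    simp only [hν₁]
    rw [div_mul_div_comm, div_mul_div_comm]
    exact div_le_div_of_nonneg_right h (mul_nonneg hq₀.le hq₀.le)
  have hdom : ∀ A : Finset α, IsUpperSet (A : Set α) → mass ν₀ A ≤ mass ν₁ A :=
    fun A hA' => sections_dominated_of_fkg_lattice hν hq₀ hq₁ A hA'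
  have hqle : q ≤ 1 := by linarith [hq1, hq₁.le]
  have main := sahiE_three_sections_principalBottom_ge h₀ hl₀ h₀' h₁ hl₁ h₁' hdom hU hV hW huU hvV hwW hq₀.le hqle
  rw [← hrepr] at main
  exact main

end Lattice

end

end Summit.CriticalPhenomena.PercolationContinuityZ3.Theorems.SahiTangent
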